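import Literature.Probability.LatticeModels.MarkovWindowDensity
import HarnessLib

/-!
# Conditioning a future window observable of the stationary Markov chain on the present spin

Topic `Literature/Probability/LatticeModels`; theorems only (no definitions, no named facts).
Companion of `MarkovWindowDensity.lean` / `MarkovChainMeasure.lean` /
`MarkovChainMarkovProperty.lean` (same data and hypotheses: transfer kernel `k`, eigenfunction
`φ`, eigenvalue `L`, weight `w`, window densities `D a n`, and a measure `μ` on `ℤ → S` with the
window formula `hμ`). This file PROVES the Markov splitting of the window densities at an
interior site and, from it, the `ℝ≥0∞` / `lintegral` form of
`E[Φ Ψ] = E[Φ · E[Ψ | σ_b]]` for `Φ ≥ 0` an observable of a window `{a, …, b}` ending at `b` and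
`Ψ ≥ 0` an observable of a window `{b, …, b+m'}` starting at `b`, with the conditional
expectation `G(y) = E[Ψ | σ_b = y]` WRITTEN OUT as a normalised marginal integral:

* `dependsOn_lmarginal` — a marginal integral over `s` of a function of the coordinates in `T`
  depends only on `T ∖ s`;
* `windowDensity_mul_windowDensity`, `windowDensity_add_eq` — Markov splitting
  `D a m · D (a+m) m' = D a (m+m') · φ(σ_{a+m})² w(σ_{a+m})`;
* `lmarginal_windowDensity_update_eq` — normalisation `(∫⋯∫⁻_{b+1,…,b+m'} D b m')(σ_b = y) = φ(y)² w(y)`;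
* `lintegral_mul_eq_lintegral_mul_cond` — **the identity** `∫⁻ Φ Ψ dμ = ∫⁻ Φ(σ) G(σ_b) dμ`,
  `G(y) = (φ(y)² w(y))⁻¹ (∫⋯∫⁻_{b+1,…,b+m'} Ψ · D b m')(σ_b = y)`;
* `exists_cond_of_le` — packaged for bounded `Ψ ≤ M`: `∃ G ≤ M` measurable serving every window
  `{a, …, a+m = b}` at once.

[cite: Georgii2011, Thm 10.25 and §11.1]
-/

noncomputable section

open MeasureTheory Set Function Finset
open scoped ENNReal

namespace Literature.Probability.LatticeModels

variable {S : Type*} [MeasurableSpace S] {ν : Measure S}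

/-! ### Marginal integrals and dependence -/

/-- A marginal integral over `s` of a function depending on the coordinates in `T` depends only
on the coordinates in `T ∖ s`. [folklore] -/
theorem dependsOn_lmarginal {f : (ℤ → S) → ℝ≥0∞} {T : Set ℤ} (hf : DependsOn f T) (s : Finset ℤ) :
    DependsOn (∫⋯∫⁻_s, f ∂fun _ : ℤ => ν) (T \ ↑s) := by
  intro x y hxy
  unfold lmarginal
  refine lintegral_congr fun z => hf fun i hi => ?_
  by_cases his : i ∈ s
  · simp [updateFinset, his]
  · simp only [updateFinset, his, dite_false]
    exact hxy i ⟨hi, fun h => his (Finset.mem_coe.1 h)⟩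

section Chain

variable {k : S → S → ℝ≥0∞} {φ w : S → ℝ≥0∞} {L : ℝ≥0∞} {D : ℤ → ℕ → (ℤ → S) → ℝ≥0∞}
  {p : S → S → ℝ≥0∞} {μ : Measure (ℤ → S)}

/-! ### Markov splitting of the window densities -/

omit [MeasurableSpace S] in
/-- **Markov splitting of the window densities at an interior site**:
`D a m σ · D (a+m) m' σ = D a (m+m') σ · φ(σ_{a+m})² w(σ_{a+m})`. [folklore] -/
theorem windowDensity_mul_windowDensity
    (hD : ∀ a n σ, D a n σ = φ (σ a) * φ (σ (a + n)) *
      (∏ j ∈ Finset.range n, k (σ (a + j)) (σ (a + j + 1)) * L⁻¹) *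
      ∏ j ∈ Finset.range (n + 1), w (σ (a + j)))
    (a : ℤ) (m m' : ℕ) (σ : ℤ → S) :
    D a m σ * D (a + m) m' σ = D a (m + m') σ * (φ (σ (a + m)) ^ 2 * w (σ (a + m))) := by
  rw [hD, hD, hD]
  have e1 : (a + ↑(m + m') : ℤ) = a + ↑m + ↑m' := by push_cast; ring
  have hk : ∏ j ∈ Finset.range (m + m'), k (σ (a + j)) (σ (a + j + 1)) * L⁻¹ =
      (∏ j ∈ Finset.range m, k (σ (a + j)) (σ (a + j + 1)) * L⁻¹) *
        ∏ j ∈ Finset.range m', k (σ (a + m + j)) (σ (a + m + j + 1)) * L⁻¹ := by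
    rw [Finset.prod_range_add]
    congr 1
    refine Finset.prod_congr rfl fun j _ => ?_
    rw [show (a + ↑(m + j) : ℤ) = a + ↑m + ↑j by push_cast; ring]
  have hw : ∏ j ∈ Finset.range (m + m' + 1), w (σ (a + j)) =
      (∏ j ∈ Finset.range m, w (σ (a + j))) * ∏ j ∈ Finset.range (m' + 1), w (σ (a + m + j)) := by
    rw [show m + m' + 1 = m + (m' + 1) by ring, Finset.prod_range_add]
    congr 1
    refine Finset.prod_congr rfl fun j _ => ?_
    rw [show (a + ↑(m + j) : ℤ) = a + ↑m + ↑j by push_cast; ring]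
  have hw1 : ∏ j ∈ Finset.range (m + 1), w (σ (a + j)) =
      (∏ j ∈ Finset.range m, w (σ (a + j))) * w (σ (a + m)) := Finset.prod_range_succ _ _
  rw [e1, hk, hw, hw1]
  ring

omit [MeasurableSpace S] in
/-- `D a (m+m') σ = D a m σ · D (a+m) m' σ · (φ(σ_{a+m})² w(σ_{a+m}))⁻¹` (the Markov splitting,
divided form; `φ`, `w` nonzero and finite). [folklore] -/
theorem windowDensity_add_eq
    (hD : ∀ a n σ, D a n σ = φ (σ a) * φ (σ (a + n)) *
      (∏ j ∈ Finset.range n, k (σ (a + j)) (σ (a + j + 1)) * L⁻¹) *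
      ∏ j ∈ Finset.range (n + 1), w (σ (a + j)))
    (hφ0 : ∀ z, φ z ≠ 0) (hφt : ∀ z, φ z ≠ ∞) (hw0 : ∀ z, w z ≠ 0) (hwt : ∀ z, w z ≠ ∞)
    (a : ℤ) (m m' : ℕ) (σ : ℤ → S) :
    D a (m + m') σ = D a m σ * D (a + m) m' σ * (φ (σ (a + m)) ^ 2 * w (σ (a + m)))⁻¹ := by
  have hc0 : φ (σ (a + m)) ^ 2 * w (σ (a + m)) ≠ 0 :=
    mul_ne_zero (pow_ne_zero _ (hφ0 _)) (hw0 _)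
  have hct : φ (σ (a + m)) ^ 2 * w (σ (a + m)) ≠ ∞ :=
    ENNReal.mul_ne_top (ENNReal.pow_ne_top (hφt _)) (hwt _)
  rw [← div_eq_mul_inv, ENNReal.eq_div_iff hc0 hct, mul_comm]
  exact (windowDensity_mul_windowDensity hD a m m' σ).symm

/-! ### Conditioning a future window observable on the present spin -/

/-- **The normalisation of the conditional density**: integrating the window density `D b m'`
over the sites `b+1, …, b+m'` with `σ_b = y` gives the one-site density `φ(y)² w(y)`.
[cite: Georgii2011, Thm 10.25 and §11.1] -/
theorem lmarginal_windowDensity_update_eq [SigmaFinite ν]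
    (hk : Measurable (uncurry k)) (hφ : Measurable φ) (hw : Measurable w)
    (hL0 : L ≠ 0) (hLt : L ≠ ∞)
    (heig : ∀ z, ∫⁻ y, k z y * φ y * w y ∂ν = L * φ z) (hsym : ∀ z y, k z y = k y z)
    (hD : ∀ a n σ, D a n σ = φ (σ a) * φ (σ (a + n)) *
      (∏ j ∈ Finset.range n, k (σ (a + j)) (σ (a + j + 1)) * L⁻¹) *
      ∏ j ∈ Finset.range (n + 1), w (σ (a + j)))
    (b : ℤ) (m' : ℕ) (η : ℤ → S) (y : S) :
    (∫⋯∫⁻_Finset.Icc (b + 1) (b + m'), D b m' ∂fun _ : ℤ => ν) (Function.update η b y) =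
      φ y ^ 2 * w y := by
  have h := lmarginal_sdiff_D (ν := ν) hk hφ hw hL0 hLt heig hsym hD (a := b) (a' := b) (n := 0)
    (n' := m') le_rfl (by push_cast; omega)
  simp only [Nat.cast_zero, add_zero, Finset.Icc_self] at h
  have hset : Finset.Icc (b + 1) (b + m') = Finset.Icc b (b + m') \ {b} := by
    ext i
    simp only [Finset.mem_Icc, Finset.mem_sdiff, Finset.mem_singleton]
    omega
  rw [hset, h, hD]
  simp [sq]

/-- **Conditioning a future window observable on the present spin (Markov property).** For
measurable `Φ ≥ 0` depending on `{a, …, a+m}` and `Ψ ≥ 0` depending on `{a+m, …, a+m+m'}`,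
`∫⁻ Φ Ψ dμ = ∫⁻ Φ(σ) G(σ_{a+m}) dμ` with the conditional expectation of `Ψ` given `σ_{a+m} = y`
written out: `G(y) = (φ(y)² w(y))⁻¹ (∫⋯∫⁻_{a+m+1, …, a+m+m'} Ψ · D (a+m) m')(η with η_{a+m} = y)`.
[cite: Georgii2011, Thm 10.25 and §11.1] -/
theorem lintegral_mul_eq_lintegral_mul_cond [Nonempty S] [SigmaFinite ν]
    (hk : Measurable (uncurry k)) (hφ : Measurable φ) (hw : Measurable w)
    (hD : ∀ a n σ, D a n σ = φ (σ a) * φ (σ (a + n)) *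
      (∏ j ∈ Finset.range n, k (σ (a + j)) (σ (a + j + 1)) * L⁻¹) *
      ∏ j ∈ Finset.range (n + 1), w (σ (a + j)))
    (hφ0 : ∀ z, φ z ≠ 0) (hφt : ∀ z, φ z ≠ ∞) (hw0 : ∀ z, w z ≠ 0) (hwt : ∀ z, w z ≠ ∞)
    (hμ : ∀ (a : ℤ) (n : ℕ) (Φ : (ℤ → S) → ℝ≥0∞), Measurable Φ →
      DependsOn Φ (↑(Finset.Icc a (a + n)) : Set ℤ) → ∀ η : ℤ → S,
        ∫⁻ σ, Φ σ ∂μ = (∫⋯∫⁻_Finset.Icc a (a + n), (fun σ => Φ σ * D a n σ) ∂fun _ : ℤ => ν) η)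
    {a : ℤ} {m m' : ℕ} {Φ Ψ : (ℤ → S) → ℝ≥0∞} (hΦm : Measurable Φ)
    (hΦd : DependsOn Φ (↑(Finset.Icc a (a + m)) : Set ℤ)) (hΨm : Measurable Ψ)
    (hΨd : DependsOn Ψ (↑(Finset.Icc (a + m) (a + m + m')) : Set ℤ)) (η : ℤ → S) :
    ∫⁻ σ, Φ σ * Ψ σ ∂μ = ∫⁻ σ, Φ σ * ((φ (σ (a + m)) ^ 2 * w (σ (a + m)))⁻¹ *
      (∫⋯∫⁻_Finset.Icc (a + m + 1) (a + m + m'), (fun ζ => Ψ ζ * D (a + m) m' ζ) ∂fun _ : ℤ => ν)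
        (Function.update η (a + m) (σ (a + m)))) ∂μ := by
  set W₂ : Finset ℤ := Finset.Icc (a + m + 1) (a + m + m') with hW₂
  set G : S → ℝ≥0∞ := fun y => (φ y ^ 2 * w y)⁻¹ *
    (∫⋯∫⁻_W₂, (fun ζ => Ψ ζ * D (a + m) m' ζ) ∂fun _ : ℤ => ν) (Function.update η (a + m) y)
    with hG
  change _ = ∫⁻ σ, Φ σ * G (σ (a + m)) ∂μ
  have hDm := measurable_D hk hφ hw hD
  have hGm : Measurable G :=
    (((hφ.pow_const 2).mul hw).inv).mul (((hΨm.mul (hDm _ _)).lmarginal _).comp (measurable_update η))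
  -- both sides through the window formula
  have hdepL : DependsOn (fun σ : ℤ → S => Φ σ * Ψ σ) (↑(Finset.Icc a (a + ↑(m + m'))) : Set ℤ) := by
    intro x y hxy
    dsimp only
    rw [hΦd fun i hi => hxy i ?_, hΨd fun i hi => hxy i ?_] <;>
    · simp only [Finset.coe_Icc, Set.mem_Icc] at hi ⊢; push_cast; omega
  have hdepR : DependsOn (fun σ : ℤ → S => Φ σ * G (σ (a + m))) (↑(Finset.Icc a (a + m)) : Set ℤ) := by
    intro x y hxy
    dsimp only
    rw [hΦd hxy, hxy (a + m) (by simp)]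
  rw [hμ a (m + m') (fun σ => Φ σ * Ψ σ) (hΦm.mul hΨm) hdepL η,
    hμ a m (fun σ => Φ σ * G (σ (a + m))) (hΦm.mul (hGm.comp (measurable_pi_apply _))) hdepR η]
  -- split `{a, …, a+m+m'} = {a, …, a+m} ∪ W₂` and integrate over `W₂` first
  have hsplit : Finset.Icc a (a + ↑(m + m')) = Finset.Icc a (a + m) ∪ W₂ := by
    ext i
    simp only [hW₂, Finset.mem_Icc, Finset.mem_union]
    push_cast
    omega
  have hdisj : Disjoint (Finset.Icc a (a + m)) W₂ := Finset.disjoint_left.2 fun i hi hi' => by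
    simp only [hW₂, Finset.mem_Icc] at hi hi'; omega
  have hmeas3 : Measurable fun σ : ℤ → S => Φ σ * Ψ σ * D a (m + m') σ := (hΦm.mul hΨm).mul (hDm _ _)
  rw [hsplit, lmarginal_union _ (fun σ => Φ σ * Ψ σ * D a (m + m') σ) hmeas3 hdisj]
  have hfun : (∫⋯∫⁻_W₂, (fun σ => Φ σ * Ψ σ * D a (m + m') σ) ∂fun _ : ℤ => ν) =
      fun x => Φ x * G (x (a + m)) * D a m x := by
    funext x
    have hrw : (fun σ => Φ σ * Ψ σ * D a (m + m') σ) = fun σ =>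
        (Φ σ * D a m σ * (φ (σ (a + m)) ^ 2 * w (σ (a + m)))⁻¹) * (Ψ σ * D (a + m) m' σ) := by
      funext σ
      rw [windowDensity_add_eq hD hφ0 hφt hw0 hwt]
      ring
    have hdepF : DependsOn (fun σ => Φ σ * D a m σ * (φ (σ (a + m)) ^ 2 * w (σ (a + m)))⁻¹)
        (↑(Finset.Icc a (a + m)) : Set ℤ) := by
      intro x' y' hxy
      dsimp only
      rw [hΦd hxy, dependsOn_D hD a m hxy, hxy (a + m) (by simp)]
    rw [hrw, lmarginal_mul_left_of_dependsOn' (ν := ν) (f := fun σ => Ψ σ * D (a + m) m' σ) hdepF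
      hdisj.symm (hΨm.mul (hDm _ _)) x]
    have hGx : (∫⋯∫⁻_W₂, (fun ζ => Ψ ζ * D (a + m) m' ζ) ∂fun _ : ℤ => ν)
        (Function.update η (a + m) (x (a + m))) =
        (∫⋯∫⁻_W₂, (fun ζ => Ψ ζ * D (a + m) m' ζ) ∂fun _ : ℤ => ν) x := by
      have hdep : DependsOn (fun ζ => Ψ ζ * D (a + m) m' ζ)
          (↑(Finset.Icc (a + m) (a + m + m')) : Set ℤ) := by
        intro x' y' hxy
        dsimp only
        rw [hΨd hxy, dependsOn_D hD (a + m) m' hxy]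
      refine dependsOn_lmarginal (ν := ν) hdep W₂ fun i hi => ?_
      obtain ⟨h1, h2⟩ := hi
      have hi' : i = a + m := by
        simp only [hW₂, Finset.coe_Icc, Set.mem_Icc] at h1 h2; omega
      subst hi'
      simp
    simp only [hG]
    rw [hGx]
    ring
  rw [hfun]

/-- **Conditional expectation of a bounded future window observable given the present spin
(packaged).** For a measurable `Ψ ≤ M` depending on `{b, …, b+m'}` there is a measurable
`G ≤ M` on `S` with `∫⁻ Φ Ψ dμ = ∫⁻ Φ(σ) G(σ_b) dμ` for every measurable `Φ ≥ 0` of a window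
`{a, …, b}` ending at `b` (`G(y) = E[Ψ | σ_b = y]`, explicit in
`lintegral_mul_eq_lintegral_mul_cond`; the bound is the normalisation
`lmarginal_windowDensity_update_eq`). [cite: Georgii2011, Thm 10.25 and §11.1] -/
theorem exists_cond_of_le [Nonempty S] [SigmaFinite ν]
    (hk : Measurable (uncurry k)) (hφ : Measurable φ) (hw : Measurable w)
    (hL0 : L ≠ 0) (hLt : L ≠ ∞)
    (heig : ∀ z, ∫⁻ y, k z y * φ y * w y ∂ν = L * φ z) (hsym : ∀ z y, k z y = k y z)
    (hD : ∀ a n σ, D a n σ = φ (σ a) * φ (σ (a + n)) *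
      (∏ j ∈ Finset.range n, k (σ (a + j)) (σ (a + j + 1)) * L⁻¹) *
      ∏ j ∈ Finset.range (n + 1), w (σ (a + j)))
    (hφ0 : ∀ z, φ z ≠ 0) (hφt : ∀ z, φ z ≠ ∞) (hw0 : ∀ z, w z ≠ 0) (hwt : ∀ z, w z ≠ ∞)
    (hμ : ∀ (a : ℤ) (n : ℕ) (Φ : (ℤ → S) → ℝ≥0∞), Measurable Φ →
      DependsOn Φ (↑(Finset.Icc a (a + n)) : Set ℤ) → ∀ η : ℤ → S,
        ∫⁻ σ, Φ σ ∂μ = (∫⋯∫⁻_Finset.Icc a (a + n), (fun σ => Φ σ * D a n σ) ∂fun _ : ℤ => ν) η)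
    {b : ℤ} {m' : ℕ} {Ψ : (ℤ → S) → ℝ≥0∞} (hΨm : Measurable Ψ)
    (hΨd : DependsOn Ψ (↑(Finset.Icc b (b + m')) : Set ℤ)) {M : ℝ≥0∞} (hΨM : ∀ σ, Ψ σ ≤ M) :
    ∃ G : S → ℝ≥0∞, Measurable G ∧ (∀ y, G y ≤ M) ∧
      ∀ (a : ℤ) (m : ℕ) (Φ : (ℤ → S) → ℝ≥0∞), a + m = b → Measurable Φ →
        DependsOn Φ (↑(Finset.Icc a (a + m)) : Set ℤ) →
          ∫⁻ σ, Φ σ * Ψ σ ∂μ = ∫⁻ σ, Φ σ * G (σ b) ∂μ := by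
  classical
  set η : ℤ → S := fun _ => Classical.arbitrary S
  have hDm := measurable_D hk hφ hw hD
  refine ⟨fun y => (φ y ^ 2 * w y)⁻¹ * (∫⋯∫⁻_Finset.Icc (b + 1) (b + m'),
    (fun ζ => Ψ ζ * D b m' ζ) ∂fun _ : ℤ => ν) (Function.update η b y), ?_, fun y => ?_, ?_⟩
  · exact (((hφ.pow_const 2).mul hw).inv).mul
      (((hΨm.mul (hDm _ _)).lmarginal _).comp (measurable_update η))
  · have hc0 : φ y ^ 2 * w y ≠ 0 := mul_ne_zero (pow_ne_zero _ (hφ0 _)) (hw0 _)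
    have hct : φ y ^ 2 * w y ≠ ∞ := ENNReal.mul_ne_top (ENNReal.pow_ne_top (hφt _)) (hwt _)
    have hle : (∫⋯∫⁻_Finset.Icc (b + 1) (b + m'), (fun ζ => Ψ ζ * D b m' ζ) ∂fun _ : ℤ => ν)
        (Function.update η b y) ≤ (∫⋯∫⁻_Finset.Icc (b + 1) (b + m'), (fun ζ => M * D b m' ζ)
          ∂fun _ : ℤ => ν) (Function.update η b y) :=
      lmarginal_mono (fun ζ => mul_le_mul' (hΨM ζ) le_rfl) _
    have hconst : (∫⋯∫⁻_Finset.Icc (b + 1) (b + m'), (fun ζ => M * D b m' ζ) ∂fun _ : ℤ => ν)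
        (Function.update η b y) = M * (φ y ^ 2 * w y) := by
      rw [← lmarginal_windowDensity_update_eq hk hφ hw hL0 hLt heig hsym hD b m' η y]
      unfold lmarginal
      exact lintegral_const_mul _ ((hDm _ _).comp measurable_updateFinset)
    dsimp only
    calc (φ y ^ 2 * w y)⁻¹ * (∫⋯∫⁻_Finset.Icc (b + 1) (b + m'), (fun ζ => Ψ ζ * D b m' ζ)
          ∂fun _ : ℤ => ν) (Function.update η b y)
        ≤ (φ y ^ 2 * w y)⁻¹ * (M * (φ y ^ 2 * w y)) := by rw [← hconst]; gcongr
      _ = M * ((φ y ^ 2 * w y)⁻¹ * (φ y ^ 2 * w y)) := by ring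
      _ = M := by rw [ENNReal.inv_mul_cancel hc0 hct, mul_one]
  · intro a m Φ hab hΦm hΦd
    subst hab
    exact lintegral_mul_eq_lintegral_mul_cond hk hφ hw hD hφ0 hφt hw0 hwt hμ hΦm hΦd hΨm hΨd η

end Chain

end Literature.Probability.LatticeModels

end
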